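import Summits.AtomisticToContinuum.HydrodynamicLimit.Theses.OneSphereInfluence
import Summits.AtomisticToContinuum.HydrodynamicLimit.Theorems.ImplosionDichotomyHsEosLowDensity
import Summits.AtomisticToContinuum.HydrodynamicLimit.Theorems.ImplosionDichotomyPolynomialCompressionSolutionAPI
import Literature.MathematicalPhysics.KineticTheory.HardSphereEulerLLN
import Literature.MathematicalPhysics.KineticTheory.HardSphereEulerProofs
import Literature.MathematicalPhysics.KineticTheory.HardSphereEulerDim
import Literature.Analysis.FunctionSpaces.TorusSpaceTimeComposition
import Literature.Analysis.FunctionSpaces.TorusCalculusProofs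
import HarnessLib

/-!
# PreShockDoor (decomp-a2c lens-1 g40) — door-typing node for `OneSphereInfluence.PreShockHomotopy`
# (landed in four parts by hand-2 g15: `PreShockDoorPieces` (this file: pieces + [I]), `PreShockDoorScaling` ([E]), `PreShockDoorHelpers`, `PreShockDoorKernel` (the door))

`PreShockHomotopy` (stmt-AtomisticToContinuum-13621, binder `hP` of the deciding theorem `closes`
of route `OneSphereInfluence`) ⟸ `[WD] ∧ [S]` (+ the PROVED tree theorem `[U]` carried by
value, see below; the two other pieces `[E]` and `[I]` of the four-piece assembly are PROVED in this
file), with the assembly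
`preShockHomotopy_of : SmoothFamilyWellposedness → CoolSlowScaling → LocalEosStatics →
LLNDataIdentification → ClassicalUniquenessSmallPacking → Theses.OneSphereInfluence.PreShockHomotopy`
and the door kernels `preShockHomotopy_of' : [WD] → [E] → [S] → [U] → …` and
`preShockHomotopy_door : SmoothFamilyWellposedness → LocalEosStatics →
ClassicalUniquenessSmallPacking → Theses.OneSphereInfluence.PreShockHomotopy`
PROVED (sorry-free, axioms `propext · Classical.choice · Quot.sound`).

GUARD-FREE. Unlike the registered birth skeleton `Cruxes/PreShockHomotopy/Lines/birth.lean`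
(`PreShockHomotopy_of : stub_statics → stub_families → DiluteSelfConsistency → HsEosLowDensity → …`,
2026-08-17), this door does NOT route through `ImplosionDichotomy.DiluteSelfConsistency`
(stmt-3091, suspect-false by implosion) nor through any packing guard on the target solution: the
members near `κ = 1` are EXACT cool-and-slow scalings of the target itself ([E]), so no PDE theorem
(stability, continuation, uniqueness at large packing) is ever applied to the target beyond a short
initial window `[0, T₂)` on which its packing is small by continuity (tube lemma). The XL stub
`PreShockFamilies` of the birth line shrinks to the classical, parameter-smooth SHORT-time statement
[WD] on mass-one convex interpolation data, and the hull constant is `Λ = 1`.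

Pieces (each a `def … : Prop`, tagged):
* `[WD] SmoothFamilyWellposedness` — KNOWN·ABSENT (WEAKER): short-time well-posedness of the
  hard-sphere Euler system, jointly smooth in a compact one-parameter family of smooth data at
  small packing (Kato 1975 Thms II–III; Majda 1984 Thm 2.1; smooth dependence on parameters /
  "parameters as extra variables"). Literature-side absentee: the tree has `hsEuler_localExistence`
  (no uniform life span, no parameter) and `hsEuler_continuousDependence` (ideal-gas reference only).
* `[E] CoolSlowScaling` — PROVED IN THIS FILE (`coolSlowScaling_holds`): the exact cool-and-slow
  symmetry `(ρ, λu, λ²θ)(λt)` of classical solutions (`p = ρθZ(ρσ³)` is linear in `θ`), junk-free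
  (chain rule `HasDerivWithinAt.scomp` in time; in space the linearity `∂ᵢ(k•G) = k•∂ᵢG`,
  `∇(k p) = k•∇p` holds WITHOUT differentiability, `deriv_const_smul_always` / `gradient_const_mul_always`).
* `[S] LocalEosStatics` — ATTACKABLE·M (WEAKER): the `t = 0` LLN of the local Gibbs laws with the
  LOCAL equation of state `G_σ` (density = `G(e^μ a(x))`, `G`, `G⁻¹` smooth, `G` strictly
  increasing), uniformly over activities in `[B⁻¹, B]` (re-packaging of the tree's cluster expansion
  `localGibbs_lln_holds`: `G(z) = ∑ γ_j(σ) z^{j+1}`, `e^μ = ratioLimit/∫a`; nearest prior typing: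
  the moot item `AmplitudeAnalyticity.LocalGibbsStatics`, stmt-5613).
* `[I] LLNDataIdentification` — PROVED IN THIS FILE (`llnDataIdentification_holds`): limits in
  probability under probability measures are unique, so two continuous macroscopic data with the
  same `t = 0` LLN coincide; hence the door proper is `PreShockHomotopy ⟸ [WD] ∧ [S]`
  (`preShockHomotopy_door`).
* `[U] ClassicalUniquenessSmallPacking` — NOT a piece: the verbatim statement of the PROVED tree
  theorem `hsEuler_uniqueness_smallPacking` (`HardSphereEulerClassicalUniqueness.lean:611`), carried
  as a hypothesis only because that module had no hub olean when this node was checked (farm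
  `remote:stale:unbuilt`); discharge: `preShockHomotopy_door hWD hSt hsEuler_uniqueness_smallPacking`.

Tree levers CITED (all proved): `Theorems.hsEosLowDensity_proof` (virial analyticity, discharges the
EoS hypothesis of [WD] and of [U]), `hsEuler_uniqueness_smallPacking` (Dafermos 5.2.1, = [U]),
`isHardSphereEulerSolution_restrict` / `_isSmooth_slice` (Theorems…SolutionAPI), `isProbabilityMeasure_localGibbsLaw`,
`IsHardSphereEulerSolutionDim.const` + `isHardSphereEulerSolutionDim_three_iff`.

The path (kernel): density data `d_m = (1-m)·1 + m ρ(0,·)` (mass one ⇒ inside the hull, `Λ = 1`),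
activities `a_κ = e^{-μ₁} G⁻¹∘d_{m(κ)}`, velocities/temperatures scaled by `λ(κ)`, `λ(κ)²`;
members `κ ≤ 5/8`: `S_{λ₀} V_{m(κ)}` with `V` the jointly smooth short-time family of [WD];
members `κ > 5/8`: `S_{λ(κ)}` of the TARGET solution (life span `T/λ ≥ T`, no stability theorem);
flat plateaus `m ≡ 1` on `[1/2, 1]`, `λ ≡ λ₀` on `[0, 3/4]` make the two formulas agree on the
overlap `(1/2, 3/4)` (classical uniqueness at small packing), so joint smoothness is local.
-/

noncomputable section

open Set Filter MeasureTheory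
open scoped Topology ContDiff ENNReal
open Literature.MathematicalPhysics.KineticTheory Literature.Analysis.FunctionSpaces

namespace Summit.AtomisticToContinuum.HydrodynamicLimit.Theorems.PreShockDoor

/-! ## The four pieces (+ the by-value tree input [U]) -/

/-- **[WD] piece · KNOWN·ABSENT · WEAKER than the crux (pure PDE, no particles).**
Short-time well-posedness of the hard-sphere Euler system, jointly smooth in a compact
one-parameter family of data, at small packing: if the excess free energy is analytic near `0`
(tree theorem `hsEosLowDensity_proof`), there is `η₁ > 0` such that for every `σ > 0` and every
family of smooth positive data `(ρ₀, u₀, θ₀)_m`, `m ∈ [0,1]`, jointly `C^∞` in `(m, x)` with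
packing `ρ₀σ³ ≤ η₁`, there are a common time `T > 0` and classical solutions on `[0, T)` with these
data, jointly `C^∞` in `(m, t, x)` on `[0,1] × [0,T) × 𝕋³`.
Sources: Kato1975 (ARMA 58) Thms II–III; Majda1984 Thm 2.1; Dafermos2005 Thm 5.1.1 (uniform time on
bounded data sets; smooth dependence on parameters by differentiating the symmetric hyperbolic
system). Why it might fail: only through a typing slip (one-sided smoothness at `m = 0, 1`,
`t = 0` is meant within the set, as everywhere in this tree). -/
def SmoothFamilyWellposedness : Prop :=
  ∀ η₀ : ℝ, 0 < η₀ → ∀ F : ℝ → ℝ, AnalyticOnNhd ℝ F (Ioo (-η₀) η₀) →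
    EqOn hsExcessFreeEnergy F (Ico 0 η₀) →
    ∃ η₁ : ℝ, 0 < η₁ ∧ ∀ σ : ℝ, 0 < σ →
      ∀ (ρ₀ θ₀ : ℝ → T3 → ℝ) (u₀ : ℝ → T3 → V3),
        Torus.IsSmoothSpaceTimeOn (Icc 0 1) ρ₀ → Torus.IsSmoothSpaceTimeOn (Icc 0 1) θ₀ →
        Torus.IsSmoothSpaceTimeOn (Icc 0 1) u₀ →
        (∀ m ∈ Icc (0:ℝ) 1, ∀ x, 0 < ρ₀ m x) → (∀ m ∈ Icc (0:ℝ) 1, ∀ x, 0 < θ₀ m x) →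
        (∀ m ∈ Icc (0:ℝ) 1, ∀ x, ρ₀ m x * σ ^ 3 ≤ η₁) →
        ∃ T : ℝ, 0 < T ∧ ∃ (ρ θ : ℝ → ℝ → T3 → ℝ) (u : ℝ → ℝ → T3 → V3),
          (∀ m ∈ Icc (0:ℝ) 1, IsHardSphereEulerSolution σ T (ρ m) (u m) (θ m) ∧
            ρ m 0 = ρ₀ m ∧ u m 0 = u₀ m ∧ θ m 0 = θ₀ m) ∧
          ContDiffOn ℝ ∞ (fun q : ℝ × ℝ × EuclideanSpace ℝ (Fin 3) => ρ q.1 q.2.1 (Torus.proj q.2.2))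
            (Icc 0 1 ×ˢ (Ico 0 T ×ˢ univ)) ∧
          ContDiffOn ℝ ∞ (fun q : ℝ × ℝ × EuclideanSpace ℝ (Fin 3) => u q.1 q.2.1 (Torus.proj q.2.2))
            (Icc 0 1 ×ˢ (Ico 0 T ×ˢ univ)) ∧
          ContDiffOn ℝ ∞ (fun q : ℝ × ℝ × EuclideanSpace ℝ (Fin 3) => θ q.1 q.2.1 (Torus.proj q.2.2))
            (Icc 0 1 ×ˢ (Ico 0 T ×ˢ univ))

/-- **[E] piece · PROVED below (`coolSlowScaling_holds`) · WEAKER (an exact symmetry, no particles).**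
Cool-and-slow scaling: if `(ρ, u, θ)` is a classical hard-sphere Euler solution on `[0, T)` then
`(s, x) ↦ (ρ, c u, c² θ)(c s, x)` is one on `[0, T/c)` for every `c > 0` (the pressure
`ρ θ Z(ρσ³)` and the energy `ρ(|u|²/2 + 3θ/2)` scale by `c²`, the fluxes by `c³`; every identity
is junk-free — time: `Torus.IsSmoothSpaceTimeOn.hasDerivWithinAt_slice` + `HasDerivWithinAt.scomp` with
`τ ↦ c τ`, `MapsTo (Ico 0 (T/c)) (Ico 0 T)`, `uniqueDiffOn_Ico`; space: `∂ᵢ(k • G) = k • ∂ᵢG` and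
`Torus.gradient (c² p) = c² • Torus.gradient p` in the differentiable AND in the junk case
(`deriv_const_smul_always`, `gradient_const_mul_always`: `fderiv_zero_of_not_differentiableAt` both sides)).
Sources: CourantFriedrichs1948 §17 (similarity of gas flows); Spohn1991 Part I Ch. 3. -/
def CoolSlowScaling : Prop :=
  ∀ (σ T c : ℝ) (ρ θ : ℝ → T3 → ℝ) (u : ℝ → T3 → V3), 0 < c →
    IsHardSphereEulerSolution σ T ρ u θ →
    IsHardSphereEulerSolution σ (T / c) (fun s x => ρ (c * s) x) (fun s x => c • u (c * s) x)
      (fun s x => c ^ 2 * θ (c * s) x)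

/-- **[S] piece · ATTACKABLE·M · WEAKER (statics at `t = 0` only).**
Low-density statics of the local Gibbs laws with the LOCAL equation of state: for activity bounds
`B ≥ 1` and `σ < σ₀(B)` there are `G = G_σ` (density as a function of fugacity,
`G(z) = ∑_j γ_j(σ) z^{j+1}`) and `G⁻¹`, smooth, `G` strictly increasing, inverse to each other on
the stated ranges, such that for every continuous activity `a` with values in `[B⁻¹, B]` and all
continuous `θ₀ > 0`, `u₀` there is a chemical potential `μ` with `∫ G(e^μ a) = 1`,
`e^μ a ∈ [0, 2B²]`, `G(e^μ a) ≤ 4B²`, and the empirical density / momentum / energy fields at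
time `0` converge in probability (through any flows) to `(G(e^μ a(x)), u₀, θ₀)`.
In the tree: `localGibbs_lln_holds` gives exactly this with `e^μ = ratioLimit/∫a` and
`rhoLim = G(Rβ)` but with `σ₀` per profile and `ρ₀` existential; what is to be added is the
`B`-uniform `σ₀` (`exists_smallDensity` is monotone in `sup β`, `inf β`) and the power-series
calculus of `G` (smooth, `G' = 1 + O(σ³)`, inverse function). Nearest prior typing: moot item
`AmplitudeAnalyticity.LocalGibbsStatics` (stmt-5613). Sources: Ruelle1969 Thm 4.2.3;
LebowitzPenrose1964; Spohn1991 Part I §2.3. Why it might fail: a slip in the ranges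
(`[0,2B²] → [0,4B²] → [0,8B²]`), all with factor-2 slack at small `σ`. -/
def LocalEosStatics : Prop :=
  ∀ B : ℝ, 1 ≤ B → ∃ σ₀ : ℝ, 0 < σ₀ ∧ ∀ σ : ℝ, 0 < σ → σ < σ₀ →
    ∃ G Ginv : ℝ → ℝ,
      ContDiffOn ℝ ∞ G (Ioo (-1) (16 * B ^ 2)) ∧ ContDiffOn ℝ ∞ Ginv (Ioo (-1) (8 * B ^ 2)) ∧
      StrictMonoOn G (Icc 0 (8 * B ^ 2)) ∧
      (∀ z ∈ Icc (0:ℝ) (8 * B ^ 2), Ginv (G z) = z) ∧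
      (∀ y ∈ Icc (0:ℝ) (4 * B ^ 2), G (Ginv y) = y ∧ Ginv y ∈ Icc (0:ℝ) (8 * B ^ 2)) ∧
      ∀ (a θ₀ : T3 → ℝ) (u₀ : T3 → V3), Continuous a → Continuous θ₀ → Continuous u₀ →
        (∀ x, B⁻¹ ≤ a x ∧ a x ≤ B) → (∀ x, 0 < θ₀ x) →
        ∃ μ : ℝ, (∫ x, G (Real.exp μ * a x) = 1) ∧
          (∀ x, Real.exp μ * a x ∈ Icc (0:ℝ) (2 * B ^ 2)) ∧
          (∀ x, G (Real.exp μ * a x) ≤ 4 * B ^ 2) ∧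
          ∀ Φ : (N : ℕ) → Literature.Analysis.FluidPDE.HardSphereFlow
              (Literature.Analysis.FluidPDE.Torus.geometry (Fin 3)) (hsDiameter σ N) (N + 1),
            TendstoHydroFieldsAt (fun N => localGibbsLaw σ a u₀ θ₀ N (Φ N)) Φ
              (fun _ x => G (Real.exp μ * a x)) (fun _ => u₀) (fun _ => θ₀) 0

/-- **[I] piece · PROVED below (`llnDataIdentification_holds`) · WEAKER (soft measure theory).**
Identification of LLN data: if the empirical density / momentum / energy fields at time `0`
converge in probability, under the same probability laws and flows, both to `(ρ, ρu, E)(0)` and to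
`(ρ', ρ'u', E')(0)` with continuous slices and `ρ(0,·) > 0`, then the data coincide (limits in
probability are unique; continuous functions with equal integrals against all continuous tests are
equal; divide by `ρ > 0`). Sources: folklore; OllaVaradhanYau1993 §1 (the convergence notion). -/
def LLNDataIdentification : Prop :=
  ∀ (σ : ℝ) (Φ : (N : ℕ) → Literature.Analysis.FluidPDE.HardSphereFlow
      (Literature.Analysis.FluidPDE.Torus.geometry (Fin 3)) (hsDiameter σ N) (N + 1))
    (P : (N : ℕ) → Measure (Literature.Analysis.FluidPDE.Config (N + 1) (Fin 3) T3)),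
    (∀ N, IsProbabilityMeasure (P N)) →
    ∀ (ρ θ ρ' θ' : ℝ → T3 → ℝ) (u u' : ℝ → T3 → V3),
      Continuous (ρ 0) → Continuous (u 0) → Continuous (θ 0) →
      Continuous (ρ' 0) → Continuous (u' 0) → Continuous (θ' 0) → (∀ x, 0 < ρ 0 x) →
      TendstoHydroFieldsAt P Φ ρ u θ 0 → TendstoHydroFieldsAt P Φ ρ' u' θ' 0 →
      ρ 0 = ρ' 0 ∧ u 0 = u' 0 ∧ θ 0 = θ' 0

/-- **[U] input · IN-TREE THEOREM, carried BY VALUE (costume of a PROVED tree theorem).**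
Verbatim statement of `Literature.MathematicalPhysics.KineticTheory.hsEuler_uniqueness_smallPacking`
(`Literature/MathematicalPhysics/KineticTheory/HardSphereEulerClassicalUniqueness.lean:611`, PROVED,
sorry-free; Dafermos2005 Thm 5.2.1: classical solutions with small packing and equal data coincide).
It is a HYPOTHESIS of `preShockHomotopy_of` only because that module has no hub olean at the time of
writing (farm verdict `remote:stale:…:unbuilt:…HardSphereEulerClassicalUniqueness`, 2026-08-31T19Z), so
a file importing it cannot be elaborated; the discharge is the one-liner
`preShockHomotopy_door hWD hSt hsEuler_uniqueness_smallPacking`. Not a piece of the door. -/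
def ClassicalUniquenessSmallPacking : Prop :=
  ∀ η₀ : ℝ, 0 < η₀ → ∀ F : ℝ → ℝ, AnalyticOnNhd ℝ F (Ioo (-η₀) η₀) →
    EqOn hsExcessFreeEnergy F (Ico 0 η₀) →
    ∃ η₁ : ℝ, 0 < η₁ ∧ ∀ σ : ℝ, 0 < σ →
      ∀ (T : ℝ) (ρ θ : ℝ → T3 → ℝ) (u : ℝ → T3 → V3) (ρ' θ' : ℝ → T3 → ℝ) (u' : ℝ → T3 → V3),
        IsHardSphereEulerSolution σ T ρ u θ → IsHardSphereEulerSolution σ T ρ' u' θ' →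
        (∀ t ∈ Ico 0 T, ∀ x, ρ t x * σ ^ 3 ≤ η₁) → (∀ t ∈ Ico 0 T, ∀ x, ρ' t x * σ ^ 3 ≤ η₁) →
        ρ 0 = ρ' 0 → u 0 = u' 0 → θ 0 = θ' 0 →
        ∀ t ∈ Ico 0 T, ρ t = ρ' t ∧ u t = u' t ∧ θ t = θ' t

/-! ## [I] is a theorem (proved here) -/

/-- **Limits in probability are unique** (deterministic limits, probability measures). [folklore] -/
theorem eq_of_tendsto_prob {Ω : ℕ → Type*} [∀ N, MeasurableSpace (Ω N)] {E : Type*}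
    [NormedAddCommGroup E] (P : (N : ℕ) → Measure (Ω N)) (hP : ∀ N, IsProbabilityMeasure (P N))
    (X : (N : ℕ) → Ω N → E) {c c' : E}
    (h : ∀ δ > (0:ℝ), Tendsto (fun N => P N {z | δ < ‖X N z - c‖}) atTop (𝓝 0))
    (h' : ∀ δ > (0:ℝ), Tendsto (fun N => P N {z | δ < ‖X N z - c'‖}) atTop (𝓝 0)) : c = c' := by
  by_contra hne
  have hd : 0 < ‖c - c'‖ := norm_pos_iff.2 (sub_ne_zero.2 hne)
  obtain ⟨δ, hδ_def⟩ : ∃ δ : ℝ, δ = ‖c - c'‖ / 3 := ⟨_, rfl⟩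
  have hδpos : 0 < δ := by rw [hδ_def]; positivity
  have hlim := (h δ hδpos).add (h' δ hδpos)
  rw [add_zero] at hlim
  obtain ⟨N, hN⟩ := (hlim.eventually (gt_mem_nhds zero_lt_one)).exists
  have hcover : (univ : Set (Ω N)) ⊆ {z | δ < ‖X N z - c‖} ∪ {z | δ < ‖X N z - c'‖} := by
    intro z _
    by_contra hz
    simp only [mem_union, mem_setOf_eq, not_or, not_lt] at hz
    have htri : ‖c - c'‖ ≤ ‖X N z - c‖ + ‖X N z - c'‖ := by
      calc ‖c - c'‖ = ‖(X N z - c') - (X N z - c)‖ := by congr 1; abel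
        _ ≤ ‖X N z - c'‖ + ‖X N z - c‖ := norm_sub_le _ _
        _ = ‖X N z - c‖ + ‖X N z - c'‖ := add_comm _ _
    have : ‖c - c'‖ = 3 * δ := by rw [hδ_def]; ring
    linarith [hz.1, hz.2]
  haveI := hP N
  have h1 : (1 : ℝ≥0∞) ≤ P N {z | δ < ‖X N z - c‖} + P N {z | δ < ‖X N z - c'‖} :=
    calc (1 : ℝ≥0∞) = P N univ := measure_univ.symm
      _ ≤ P N ({z | δ < ‖X N z - c‖} ∪ {z | δ < ‖X N z - c'‖}) := measure_mono hcover
      _ ≤ _ := measure_union_le _ _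
  exact absurd hN (not_lt.2 h1)

/-- A continuous function with `∫ ρ g² = 0` for a continuous weight `ρ > 0` vanishes (the Haar
measure of `𝕋³` charges open sets). [folklore] -/
theorem eq_zero_of_integral_weight_mul_self {ρ g : T3 → ℝ} (hρ : Continuous ρ) (hg : Continuous g)
    (hpos : ∀ x, 0 < ρ x) (h : ∫ x, ρ x * (g x * g x) = 0) : g = 0 := by
  have hvol : (volume : Measure (UnitAddTorus (Fin 3))).IsOpenPosMeasure := by
    rw [volume_pi]; exact inferInstance
  have hnn : ∀ x, 0 ≤ ρ x * (g x * g x) := fun x => mul_nonneg (hpos x).le (mul_self_nonneg _)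
  have hae := (integral_eq_zero_iff_of_nonneg (fun x => hnn x)
    (integrable_of_continuous_T3 (hρ.mul (hg.mul hg)))).1 h
  have hzero := (Continuous.ae_eq_iff_eq volume (hρ.mul (hg.mul hg)) continuous_const).1 hae
  funext x
  have hx := congrFun hzero x
  rcases mul_eq_zero.1 hx with h1 | h2
  · exact absurd h1 (hpos x).ne'
  · exact mul_self_eq_zero.1 h2

/-- **[I] is a theorem** (limits in probability are unique; a continuous function orthogonal to all
continuous tests vanishes; divide by `ρ(0,·) > 0`). PROVED here, so [I] leaves the door. -/
theorem llnDataIdentification_holds : LLNDataIdentification := by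
  intro σ Φ P hP ρ θ ρ' θ' u u' hρc huc hθc hρ'c hu'c hθ'c hρpos hH hH'
  have hone : Continuous fun _ : T3 => (1:ℝ) := continuous_const
  ----------------------------------------------------------------
  -- density
  ----------------------------------------------------------------
  have hdens : ∀ χ : T3 → ℝ, Continuous χ → ∫ x, χ x * ρ 0 x = ∫ x, χ x * ρ' 0 x :=
    fun χ hχ => eq_of_tendsto_prob P hP (fun N z => empiricalDensityField ((Φ N).flow 0 z) χ)
      (fun δ hδ => (hH χ hχ δ hδ).1) (fun δ hδ => (hH' χ hχ δ hδ).1)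
  have hρeq : ρ 0 = ρ' 0 := by
    have hg : Continuous fun x => ρ 0 x - ρ' 0 x := hρc.sub hρ'c
    have i1 : Integrable fun x => (ρ 0 x - ρ' 0 x) * ρ 0 x :=
      integrable_of_continuous_T3 (hg.mul hρc)
    have i2 : Integrable fun x => (ρ 0 x - ρ' 0 x) * ρ' 0 x :=
      integrable_of_continuous_T3 (hg.mul hρ'c)
    have hint : ∫ x, (1:ℝ) * ((ρ 0 x - ρ' 0 x) * (ρ 0 x - ρ' 0 x)) = 0 := by
      have e : (fun x => (1:ℝ) * ((ρ 0 x - ρ' 0 x) * (ρ 0 x - ρ' 0 x))) =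
          fun x => (ρ 0 x - ρ' 0 x) * ρ 0 x - (ρ 0 x - ρ' 0 x) * ρ' 0 x := by
        funext x; ring
      rw [e, integral_sub i1 i2, hdens _ hg, sub_self]
    have := eq_zero_of_integral_weight_mul_self hone hg (fun _ => one_pos) hint
    funext x
    exact sub_eq_zero.1 (congrFun this x)
  ----------------------------------------------------------------
  -- momentum
  ----------------------------------------------------------------
  have hmom : ∀ χ : T3 → ℝ, Continuous χ →
      ∫ x, (χ x * ρ 0 x) • u 0 x = ∫ x, (χ x * ρ' 0 x) • u' 0 x :=
    fun χ hχ => eq_of_tendsto_prob P hP (fun N z => empiricalMomentumField ((Φ N).flow 0 z) χ)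
      (fun δ hδ => (hH χ hχ δ hδ).2.1) (fun δ hδ => (hH' χ hχ δ hδ).2.1)
  have hueq : u 0 = u' 0 := by
    have hw : Continuous fun x => u 0 x - u' 0 x := huc.sub hu'c
    have hzero : ∀ χ : T3 → ℝ, Continuous χ →
        ∫ x, (χ x * ρ 0 x) • (u 0 x - u' 0 x) = 0 := by
      intro χ hχ
      have i1 : Integrable fun x => (χ x * ρ 0 x) • u 0 x :=
        integrable_of_continuous_T3 ((hχ.mul hρc).smul huc)
      have i2 : Integrable fun x => (χ x * ρ 0 x) • u' 0 x :=
        integrable_of_continuous_T3 ((hχ.mul hρc).smul hu'c)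
      simp_rw [smul_sub]
      rw [integral_sub i1 i2, hmom χ hχ, hρeq, sub_self]
    have hinner : ∀ e : V3, (fun x => inner ℝ e (u 0 x - u' 0 x)) = 0 := by
      intro e
      have hχ : Continuous fun x => inner ℝ e (u 0 x - u' 0 x) := continuous_const.inner hw
      have h0 := hzero _ hχ
      have hint : ∫ x, ρ 0 x *
          (inner ℝ e (u 0 x - u' 0 x) * inner ℝ e (u 0 x - u' 0 x)) = 0 := by
        have i3 : Integrable fun x => (inner ℝ e (u 0 x - u' 0 x) * ρ 0 x) • (u 0 x - u' 0 x) :=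
          integrable_of_continuous_T3 ((hχ.mul hρc).smul hw)
        have h3 := integral_inner (𝕜 := ℝ) i3 e
        rw [h0, inner_zero_right] at h3
        have h4 : ∫ x, ρ 0 x * (inner ℝ e (u 0 x - u' 0 x) * inner ℝ e (u 0 x - u' 0 x)) =
            ∫ x, inner ℝ e ((inner ℝ e (u 0 x - u' 0 x) * ρ 0 x) • (u 0 x - u' 0 x)) := by
          congr 1
          funext x
          rw [real_inner_smul_right]
          ring
        rw [h4]
        exact h3
      exact eq_zero_of_integral_weight_mul_self hρc hχ hρpos hint
    funext x
    have hx := congrFun (hinner (u 0 x - u' 0 x)) x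
    exact sub_eq_zero.1 (inner_self_eq_zero.1 hx)
  ----------------------------------------------------------------
  -- energy
  ----------------------------------------------------------------
  have hen : ∀ χ : T3 → ℝ, Continuous χ →
      ∫ x, χ x * totalEnergyDensity (ρ 0 x) (u 0 x) (θ 0 x) =
        ∫ x, χ x * totalEnergyDensity (ρ' 0 x) (u' 0 x) (θ' 0 x) :=
    fun χ hχ => eq_of_tendsto_prob P hP (fun N z => empiricalEnergyField ((Φ N).flow 0 z) χ)
      (fun δ hδ => (hH χ hχ δ hδ).2.2) (fun δ hδ => (hH' χ hχ δ hδ).2.2)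
  have hθeq : θ 0 = θ' 0 := by
    have hg : Continuous fun x => θ 0 x - θ' 0 x := hθc.sub hθ'c
    have hEc : ∀ ϑ : T3 → ℝ, Continuous ϑ →
        Continuous fun x => totalEnergyDensity (ρ 0 x) (u 0 x) (ϑ x) := by
      intro ϑ hϑ
      simp only [totalEnergyDensity]
      exact hρc.mul (((huc.norm.pow 2).div_const _).add (continuous_const.mul hϑ))
    have h1 := hen _ hg
    rw [← hρeq, ← hueq] at h1
    have i1 : Integrable fun x => (θ 0 x - θ' 0 x) * totalEnergyDensity (ρ 0 x) (u 0 x) (θ 0 x) :=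
      integrable_of_continuous_T3 (hg.mul (hEc _ hθc))
    have i2 : Integrable fun x => (θ 0 x - θ' 0 x) * totalEnergyDensity (ρ 0 x) (u 0 x) (θ' 0 x) :=
      integrable_of_continuous_T3 (hg.mul (hEc _ hθ'c))
    have hsub : ∫ x, ((θ 0 x - θ' 0 x) * totalEnergyDensity (ρ 0 x) (u 0 x) (θ 0 x) -
        (θ 0 x - θ' 0 x) * totalEnergyDensity (ρ 0 x) (u 0 x) (θ' 0 x)) = 0 := by
      rw [integral_sub i1 i2, h1, sub_self]
    have hint : ∫ x, ρ 0 x * ((θ 0 x - θ' 0 x) * (θ 0 x - θ' 0 x)) = 0 := by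
      have e : (fun x => ρ 0 x * ((θ 0 x - θ' 0 x) * (θ 0 x - θ' 0 x))) =
          fun x => (2 / 3 : ℝ) * ((θ 0 x - θ' 0 x) * totalEnergyDensity (ρ 0 x) (u 0 x) (θ 0 x) -
            (θ 0 x - θ' 0 x) * totalEnergyDensity (ρ 0 x) (u 0 x) (θ' 0 x)) := by
        funext x; simp only [totalEnergyDensity]; ring
      rw [e, integral_const_mul, hsub, mul_zero]
    have := eq_zero_of_integral_weight_mul_self hρc hg hρpos hint
    funext x
    exact sub_eq_zero.1 (congrFun this x)
  exact ⟨hρeq, hueq, hθeq⟩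

end Summit.AtomisticToContinuum.HydrodynamicLimit.Theorems.PreShockDoor

end
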